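import Mathlib
import HarnessLib

/-!
# OPE-space exhaustion certificates for the cutting-surface scan (Chester et al. 2020, §3.3–§3.4)

The step of a conformal-bootstrap computation that scans over the unknown external OPE
coefficients `λ⃗_ext ∈ ℝᵐ` (projectively, `[λ⃗] ∈ ℝℙ^{m−1}`), typed verbatim from
Chester–Landry–Liu–Poland–Simmons-Duffin–Su–Vichi, *Carving out OPE space and precise O(2) model
critical exponents*, JHEP 06 (2020) 142 [arXiv:1912.03324], §3.3 («Cutting surface algorithm»)
and §3.4 («Finding a point»), together with two CERTIFICATE FORMATS under which the algorithm's
terminating claim — *"𝒜_n is empty: all directions in OPE space are ruled out"* — becomes a finite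
list of real inequalities, checkable after the fact.

SOURCE (§3.3).  *"Suppose that a functional `α₁` exists obeying the condition
`λ₁ᵀ α₁(V⃗_ext) λ₁ ≥ 0`, and additionally obeying all other necessary positivity conditions … The
key observation is that `Q₁ = α₁(V⃗_ext)` defines a bilinear form that is positive not only for
`λ₁`, but also for some neighborhood `U₁ ⊂ ℝℙ³` … That is, `α₁` rules out an entire neighborhood
`U₁ ⊂ ℝℙ³`."*  Algorithm 1 (cutting surface): *"Given a list of functionals `{α₁,…,α_n}`, together
with quadratic forms `Q_i = α_i(V⃗_ext)` and regions ruled out by those quadratic forms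
`U_i ≡ {[λ] ∈ ℝℙ³ such that λᵀ Q_i λ ≥ 0}`.  The allowed region of OPE space is
`𝒜_n ≡ ℝℙ³ ∖ (∪_{i=1}^n U_i)`.  [If] `𝒜_n` is empty [then] all directions in OPE space are ruled
out."*  (§3.4) *"we are given a list of quadratic forms `Q₁,…,Q_n ∈ ℝ^{m×m}`, and we wish to find
`x = λ_{n+1} ∈ ℝᵐ` that is negative with respect to those quadratic forms.  (For the computations in
this work, `m = 4`.)  This type of problem is called a quadratically constrained quadratic program
(QCQP) … Because we solve the QCQP using heuristics, our implementation of the cutting surface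
algorithm is non-rigorous (except when `m = 2`).  It would be interesting to investigate whether
there exists a deterministic algorithm for QCQPs in low dimensions that could be useful in bootstrap
calculations."*

RENDERING.  A direction is a nonzero vector `l : Fin m → ℝ`; the family of quadratic forms is
`Q : ι → Matrix (Fin m) (Fin m) ℝ` (any index type; no symmetry is assumed — only the values
`l ⬝ᵥ Q i *ᵥ l` enter).  `ruledOut (Q i)` is `U_i` (as a cone in `ℝᵐ`), `allowedDirections Q` is
`𝒜_n` (a cone in `ℝᵐ ∖ {0}`; `mem_allowedDirections_smul`: it is a union of lines, i.e. a subset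
of `ℝℙ^{m−1}`), and `Exhausted Q` — *"all directions in OPE space are ruled out"* — is
`∀ l ≠ 0, ∃ i, 0 ≤ l ⬝ᵥ Q i *ᵥ l` (`exhausted_iff_allowedDirections_eq_empty`).  What the physics
files do with it (for every direction some functional of the list is positive on `V⃗_ext`, hence —
with the other positivity conditions, which do not involve `λ⃗_ext` — the point in dimension space is
excluded) is their business: e.g. `O2ThreeScalarCrossing.false_of_forall_class` (the `ℝℙ³` scan of
the `O(2)` system) consumes exactly a statement of the form `∀ l ≠ 0, …`.  This file is pure real
algebra and imports only Mathlib.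

WHAT IS PROVED (the two certificate formats; nothing here is specific to `m = 4`).

* (S) MULTIPLIERS — the S-procedure [cite: PolikTerlaky2007, §3.2]: *"It is trivial that the two
  systems … cannot be solved simultaneously, so if we are lucky enough to find a solution for the
  second system, then we can be sure that the first system is not solvable"*.  Here: nonnegative
  multipliers `μ`, not all zero, with `Σ_i μ_i · (lᵀ Q_i l) ≥ 0` for every `l` (for instance because
  `Σ_i μ_i Q_i ⪰ 0`) certify `Exhausted Q` (`exhausted_of_multipliers`,
  `exhausted_of_multipliers_matrix`).  For TWO homogeneous forms this relaxation is lossless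
  [cite: PolikTerlaky2007, Prop. 3.2]; in general it is only sufficient (ibid. §3.2), which is why
  the second format exists.
* (B) BOX-TREE COVERS with the vertex criterion.  (i) The polytope vertex criterion of
  Bundfuss–Dür type [cite: BundfussDur2008, Lemma 2] for axis-parallel boxes `[lo, hi] ⊆ ℝᵐ`
  (vertices `boxVertex lo hi s`, `s ⊆ Fin m` the set of coordinates sitting at `hi`): if
  `c ≤ v_sᵀ Q v_t` for all vertex pairs then `c ≤ xᵀ Q y` for all `x, y` in the box
  (`le_form_of_vertices`; proved by bilinearity — a linear functional attains its minimum over a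
  box at a vertex, `exists_vertex_dotProduct_le` — so neither symmetry of `Q` nor a sign condition
  on the box is needed), and its INTERVAL-MATRIX form (`pairLower`, `pairLower_le_form`,
  `le_form_of_intervalVertices`: entrywise bounds `Blo ≤ B ≤ Bhi` are all a verifier knows about
  `B = α(V⃗_ext)`, whose entries are values of conformal blocks).  (ii) `CoverTree ι m`: a binary
  kd-tree whose leaves name a form `k : ι` and whose nodes split a coordinate `j` at a value `c`;
  `CoverTree.Certifies test t lo hi` runs a leaf test on the leaf boxes; COVERAGE HOLDS BY
  CONSTRUCTION (`CoverTree.forall_exists_of_certifies`: the two children `[lo, hi[j ↦ c]]`,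
  `[lo[j ↦ c], hi]` of a node cover the node's box whatever `c` is).  (iii) From the cube to all
  directions (`forall_exists_of_facets`, `exhausted_of_facets`): every `l ≠ 0` is a nonzero multiple
  of a point of one of the `m` facets `F_i = {x : x_i = 1, |x_j| ≤ 1}` of the cube (divide by the
  coordinate of largest modulus; quadratic forms are even, so the facets `x_i = −1` are not needed),
  and `F_i` is the box `[facetLo i, 1]`.  MAIN: `exhausted_of_coverTrees` (one certified tree per
  facet, leaf test = the `2ᵐ × 2ᵐ` vertex-pair inequalities for the named form) and the robust
  `robustlyExhausted_of_coverTrees` (leaf test on interval matrices; conclusion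
  `RobustlyExhausted Blo Bhi`: for every direction some index `k` works for EVERY family member
  within the bounds — the form needed when `B_k = α_k(V⃗_ext)` also varies over a box of external
  dimensions), with `RobustlyExhausted.exhausted`.
* (m = 2) `exhausted_iff_angle`: for `2 × 2` forms, `Exhausted Q` is the statement
  *"for every angle `θ` some `Q_k` is nonnegative on `(cos θ, sin θ)`"* — the `θ`-scan of
  Kos–Poland–Simmons-Duffin–Vichi 2016, §2.1 (the format of `ONOPEAngleScan.false_of_forall_angle`).

RELATION TO `Literature/Analysis/ValidatedNumerics/BoxCover.lean`.  Its `KdCert α` (namespace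
`Literature.Analysis.ValidatedNumerics`) is the kernel-evaluable version of the same bookkeeping
device (boxes `List (ℚ × ℚ)`, coordinates indexed by `ℕ`, BOOLEAN leaf checks run by `decide`,
soundness `KdCert.sound`).  `CoverTree.Certifies` below is
its `Prop`-level analogue over real boxes `Fin m → ℝ`: the leaf obligations here are real
inequalities between vertex values of quadratic forms whose entries (values of conformal blocks) are
real numbers known through enclosures, to be discharged by whatever means the client file has
(`norm_num` on rational data, an interval check, or a `KdCert` run transported along `ℚ → ℝ`); no
decidability is assumed and nothing is evaluated in this file.

HONEST LIMITS.  The file certifies emptiness of `𝒜_n` from a GIVEN certificate; it contains no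
procedure producing one (bisection of the facets terminates when `max_k lᵀ Q_k l` is strictly
positive on the sphere, by compactness — not formalised, cf. the pointwise treatment in
`CopositivitySimplicialPartition`), and it says nothing about the SDP step that produces the
functionals `α_k` or about their other positivity conditions.

## References

* S. M. Chester, W. Landry, J. Liu, D. Poland, D. Simmons-Duffin, N. Su, A. Vichi, *Carving out OPE
  space and precise O(2) model critical exponents*, JHEP 06 (2020) 142. [ChesterEtAl2020]
* I. Pólik, T. Terlaky, *A survey of the S-lemma*, SIAM Review 49 (2007) 371–418. [PolikTerlaky2007]
* S. Bundfuss, M. Dür, *Algorithmic copositivity detection by simplicial partition*, Linear Algebra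
  Appl. 428 (2008) 1511–1523. [BundfussDur2008]
* F. Kos, D. Poland, D. Simmons-Duffin, A. Vichi, *Precision islands in the Ising and O(N) models*,
  JHEP 08 (2016) 036. [KosPolandSimmonsDuffinVichi2016]
-/

noncomputable section

open Finset Matrix Set

namespace Literature.MathematicalPhysics.QuantumFieldTheory.OPESpaceCoverCertificate

variable {m : ℕ} {ι : Type*}

/-! ## §3.3 verbatim: `U_i`, `𝒜_n`, "all directions ruled out" -/

/-- `U_i ≡ {[λ] : λᵀ Q_i λ ≥ 0}` — the directions ruled out by one quadratic form, as a cone in `ℝᵐ`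
[cite: ChesterEtAl2020, §3.3 (Algorithm 1, `U_i`)]. -/
def ruledOut (Q : Matrix (Fin m) (Fin m) ℝ) : Set (Fin m → ℝ) :=
  {l | 0 ≤ l ⬝ᵥ (Q *ᵥ l)}

/-- `𝒜_n ≡ ℝℙ^{m−1} ∖ ∪_i U_i` — the still-allowed directions, as a cone in `ℝᵐ ∖ {0}`
[cite: ChesterEtAl2020, §3.3 (Algorithm 1, `𝒜_n`)]. -/
def allowedDirections (Q : ι → Matrix (Fin m) (Fin m) ℝ) : Set (Fin m → ℝ) :=
  {l | l ≠ 0 ∧ ∀ i, l ⬝ᵥ (Q i *ᵥ l) < 0}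

/-- *"All directions in OPE space are ruled out"*: every nonzero `λ⃗` lies in some `U_i`
[cite: ChesterEtAl2020, §3.3 (Algorithm 1, termination `𝒜_n = ∅`)]. -/
def Exhausted (Q : ι → Matrix (Fin m) (Fin m) ℝ) : Prop :=
  ∀ l : Fin m → ℝ, l ≠ 0 → ∃ i, 0 ≤ l ⬝ᵥ (Q i *ᵥ l)

/-- `𝒜_n = (ℝᵐ ∖ {0}) ∖ ∪_i U_i` [cite: ChesterEtAl2020, §3.3 (Algorithm 1)]. -/
theorem allowedDirections_eq (Q : ι → Matrix (Fin m) (Fin m) ℝ) :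
    allowedDirections Q = {l | l ≠ 0} \ ⋃ i, ruledOut (Q i) := by
  ext l
  simp only [allowedDirections, ruledOut, mem_setOf_eq, mem_sdiff, mem_iUnion, not_exists, not_le]

/-- Termination criterion of Algorithm 1: `𝒜_n = ∅` iff every direction is ruled out
[cite: ChesterEtAl2020, §3.3 (Algorithm 1)]. -/
theorem exhausted_iff_allowedDirections_eq_empty (Q : ι → Matrix (Fin m) (Fin m) ℝ) :
    Exhausted Q ↔ allowedDirections Q = ∅ := by
  constructor
  · intro h
    ext l
    simp only [allowedDirections, mem_setOf_eq, mem_empty_iff_false, iff_false, not_and, not_forall,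
      not_lt]
    exact h l
  · intro h l hl
    by_contra hc
    have hc' : ∀ i, l ⬝ᵥ (Q i *ᵥ l) < 0 := fun i => not_le.mp fun hi => hc ⟨i, hi⟩
    have : l ∈ allowedDirections Q := ⟨hl, hc'⟩
    rw [h] at this
    exact this

/-- Homogeneity of degree two: `(c λ)ᵀ Q (c λ) = c² λᵀ Q λ` — the sets above are cones / subsets of
`ℝℙ^{m−1}` [cite: ChesterEtAl2020, §3.3 (`[λ] ∈ ℝℙ³`)]. -/
private theorem form_smul (Q : Matrix (Fin m) (Fin m) ℝ) (c : ℝ) (l : Fin m → ℝ) :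
    (c • l) ⬝ᵥ (Q *ᵥ (c • l)) = c ^ 2 * (l ⬝ᵥ (Q *ᵥ l)) := by
  rw [Matrix.mulVec_smul, dotProduct_smul, smul_dotProduct, smul_eq_mul, smul_eq_mul]
  ring

/-- `𝒜_n` is a union of lines through the origin: `c λ ∈ 𝒜_n ↔ λ ∈ 𝒜_n` for `c ≠ 0`
[cite: ChesterEtAl2020, §3.3 (`[λ] ∈ ℝℙ³`)]. -/
theorem mem_allowedDirections_smul (Q : ι → Matrix (Fin m) (Fin m) ℝ) {c : ℝ} (hc : c ≠ 0)
    (l : Fin m → ℝ) : c • l ∈ allowedDirections Q ↔ l ∈ allowedDirections Q := by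
  have hc2 : 0 < c ^ 2 := lt_of_le_of_ne (sq_nonneg c) (Ne.symm (pow_ne_zero 2 hc))
  simp only [allowedDirections, mem_setOf_eq, form_smul, smul_ne_zero_iff, ne_eq, hc,
    not_false_eq_true, true_and]
  refine and_congr Iff.rfl (forall_congr' fun i => ?_)
  constructor
  · intro h
    by_contra h'
    exact absurd h (not_lt.mpr (mul_nonneg hc2.le (not_lt.mp h')))
  · intro h
    exact mul_neg_of_pos_of_neg hc2 h

/-- The use made of exhaustion: if form `i` being nonnegative at `λ⃗` lets functional `i` exclude the
class `λ⃗` (the other positivity conditions do not involve `λ⃗_ext`), then every class is excluded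
[cite: ChesterEtAl2020, §3.3 (a point in dimension space is ruled out when `𝒜_n = ∅`)]. -/
theorem forall_of_exhausted {Q : ι → Matrix (Fin m) (Fin m) ℝ} (h : Exhausted Q)
    {P : (Fin m → ℝ) → Prop} (hP : ∀ i l, l ≠ 0 → 0 ≤ l ⬝ᵥ (Q i *ᵥ l) → P l) :
    ∀ l : Fin m → ℝ, l ≠ 0 → P l := by
  intro l hl
  obtain ⟨i, hi⟩ := h l hl
  exact hP i l hl hi

/-! ## Certificate (S): multipliers (the S-procedure) -/

/-- `λᵀ (Σ_i μ_i Q_i) λ = Σ_i μ_i λᵀ Q_i λ` [cite: PolikTerlaky2007, §3.2 (system (3.6))]. -/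
private theorem dotProduct_sum_smul_mulVec (s : Finset ι) (μ : ι → ℝ) (Q : ι → Matrix (Fin m) (Fin m) ℝ)
    (l : Fin m → ℝ) :
    l ⬝ᵥ ((∑ i ∈ s, μ i • Q i) *ᵥ l) = ∑ i ∈ s, μ i * (l ⬝ᵥ (Q i *ᵥ l)) := by
  classical
  refine Finset.induction_on s (by simp) ?_
  intro i s hi ih
  rw [Finset.sum_insert hi, Finset.sum_insert hi, Matrix.add_mulVec, dotProduct_add, ih,
    Matrix.smul_mulVec, dotProduct_smul, smul_eq_mul]

/-- **Certificate (S).**  Nonnegative multipliers, not all zero, with `Σ_i μ_i λᵀ Q_i λ ≥ 0` for all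
`λ ≠ 0` rule out every direction: *"the two systems cannot be solved simultaneously, so if we …
find a solution for the second system, then we can be sure that the first system is not solvable"*
[cite: PolikTerlaky2007, §3.2 (systems (3.5)–(3.6))]. -/
theorem exhausted_of_multipliers [Fintype ι] (Q : ι → Matrix (Fin m) (Fin m) ℝ) (μ : ι → ℝ)
    (hμ : ∀ i, 0 ≤ μ i) (hpos : ∃ i, 0 < μ i)
    (hS : ∀ l : Fin m → ℝ, l ≠ 0 → 0 ≤ ∑ i, μ i * (l ⬝ᵥ (Q i *ᵥ l))) : Exhausted Q := by
  intro l hl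
  by_contra h0
  have h : ∀ i, l ⬝ᵥ (Q i *ᵥ l) < 0 := fun i => not_le.mp fun hi => h0 ⟨i, hi⟩
  obtain ⟨i₀, hi₀⟩ := hpos
  have hlt : ∑ i, μ i * (l ⬝ᵥ (Q i *ᵥ l)) < ∑ _i : ι, (0 : ℝ) := by
    apply Finset.sum_lt_sum
    · intro i _
      exact mul_nonpos_iff.mpr (Or.inl ⟨hμ i, (h i).le⟩)
    · exact ⟨i₀, Finset.mem_univ _, mul_neg_of_pos_of_neg hi₀ (h i₀)⟩
  rw [Finset.sum_const_zero] at hlt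
  exact absurd (hS l hl) (not_le.mpr hlt)

/-- **Certificate (S), matrix form.**  If `Σ_i μ_i Q_i` has a nonnegative quadratic form (e.g. it is
positive semidefinite), `μ ≥ 0` and some `μ_i > 0`, then every direction is ruled out
[cite: PolikTerlaky2007, §3.2 (LMI relaxation (3.6)/(3.9))]. -/
theorem exhausted_of_multipliers_matrix [Fintype ι] (Q : ι → Matrix (Fin m) (Fin m) ℝ) (μ : ι → ℝ)
    (hμ : ∀ i, 0 ≤ μ i) (hpos : ∃ i, 0 < μ i)
    (hS : ∀ l : Fin m → ℝ, 0 ≤ l ⬝ᵥ ((∑ i, μ i • Q i) *ᵥ l)) : Exhausted Q :=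
  exhausted_of_multipliers Q μ hμ hpos fun l _ => by
    have := hS l
    rwa [dotProduct_sum_smul_mulVec] at this

/-! ## Certificate (B), part (i): the vertex criterion on boxes, exact and interval forms -/

/-- The vertex of the box `[lo, hi]` whose coordinates in `s` sit at `hi` and the others at `lo`
(a box is a polytope presented by its `2ᵐ` vertices) [cite: BundfussDur2008, Lemma 2 (the vertices
`v_1, …, v_n` of the simplex `Δ`); here: the vertices of an axis-parallel box]. -/
def boxVertex (lo hi : Fin m → ℝ) (s : Finset (Fin m)) : Fin m → ℝ :=
  fun j => if j ∈ s then hi j else lo j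

/-- An affine function of one variable on an interval is bounded below by its endpoint values:
`min (lo·q) (hi·q) ≤ t·q` for `t ∈ [lo, hi]` [cite: BundfussDur2008, Lemma 2 (proof: convexity
coefficients)]. -/
private theorem min_mul_le {lo hi t : ℝ} (h1 : lo ≤ t) (h2 : t ≤ hi) (q : ℝ) :
    min (lo * q) (hi * q) ≤ t * q := by
  rcases le_total 0 q with hq | hq
  · exact (min_le_left _ _).trans (mul_le_mul_of_nonneg_right h1 hq)
  · exact (min_le_right _ _).trans (mul_le_mul_of_nonpos_right h2 hq)

/-- A LINEAR functional attains its minimum over a box at a vertex: for `x ∈ [lo, hi]` there is a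
vertex `v` with `vᵀ w ≤ xᵀ w` [cite: BundfussDur2008, Lemma 2 (vertex reduction)]. -/
theorem exists_vertex_dotProduct_le (lo hi w : Fin m → ℝ) {x : Fin m → ℝ} (hx : x ∈ Icc lo hi) :
    ∃ s : Finset (Fin m), boxVertex lo hi s ⬝ᵥ w ≤ x ⬝ᵥ w := by
  classical
  refine ⟨Finset.univ.filter (fun j => hi j * w j ≤ lo j * w j), ?_⟩
  unfold dotProduct
  refine Finset.sum_le_sum fun j _ => ?_
  have hmin : min (lo j * w j) (hi j * w j) ≤ x j * w j := min_mul_le (hx.1 j) (hx.2 j) (w j)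
  by_cases h : hi j * w j ≤ lo j * w j
  · have hv : boxVertex lo hi (Finset.univ.filter (fun j => hi j * w j ≤ lo j * w j)) j = hi j := by
      simp [boxVertex, Finset.mem_filter, h]
    rw [hv]
    rw [min_eq_right h] at hmin
    exact hmin
  · have hv : boxVertex lo hi (Finset.univ.filter (fun j => hi j * w j ≤ lo j * w j)) j = lo j := by
      simp [boxVertex, Finset.mem_filter, h]
    rw [hv]
    rw [min_eq_left (le_of_lt (not_le.mp h))] at hmin
    exact hmin

/-- **Vertex criterion on a box (Bundfuss–Dür type).**  If `c ≤ v_sᵀ Q v_t` for all pairs of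
vertices of `[lo, hi]`, then `c ≤ xᵀ Q y` for all `x, y ∈ [lo, hi]`; in particular `c ≤ xᵀ Q x`
[cite: BundfussDur2008, Lemma 2 (`c = 0`), Lemma 6 (`c = −ε`); simplices there, boxes here, by
bilinearity instead of barycentric coordinates]. -/
theorem le_form_of_vertices {lo hi : Fin m → ℝ} (Q : Matrix (Fin m) (Fin m) ℝ) (c : ℝ)
    (hV : ∀ s t : Finset (Fin m), c ≤ boxVertex lo hi s ⬝ᵥ (Q *ᵥ boxVertex lo hi t))
    {x y : Fin m → ℝ} (hx : x ∈ Icc lo hi) (hy : y ∈ Icc lo hi) : c ≤ x ⬝ᵥ (Q *ᵥ y) := by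
  have h1 : ∀ s, c ≤ boxVertex lo hi s ⬝ᵥ (Q *ᵥ y) := by
    intro s
    obtain ⟨t, ht⟩ := exists_vertex_dotProduct_le lo hi (Qᵀ *ᵥ boxVertex lo hi s) hy
    rw [dotProduct_transpose_mulVec, dotProduct_transpose_mulVec] at ht
    exact (hV s t).trans ht
  obtain ⟨s, hs⟩ := exists_vertex_dotProduct_le lo hi (Q *ᵥ y) hx
  exact (h1 s).trans hs

/-- Entrywise bounds `Blo ≤ B ≤ Bhi` on a matrix (all a verifier knows about `α(V⃗_ext)`, whose
entries are values of conformal blocks) [cite: ChesterEtAl2020, §3.3 (`Q_i = α_i(V⃗_ext)`)]. -/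
def InBounds (B Blo Bhi : Matrix (Fin m) (Fin m) ℝ) : Prop :=
  ∀ i j, Blo i j ≤ B i j ∧ B i j ≤ Bhi i j

/-- The robust lower bound `Σ_{ij} min (Blo_ij u_i v_j) (Bhi_ij u_i v_j) ≤ uᵀ B v` for every `B` within
the bounds [cite: BundfussDur2008, Lemma 6 (an `ε`-relaxed vertex criterion); interval-matrix form]. -/
def pairLower (Blo Bhi : Matrix (Fin m) (Fin m) ℝ) (u v : Fin m → ℝ) : ℝ :=
  ∑ i, ∑ j, min (Blo i j * (u i * v j)) (Bhi i j * (u i * v j))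

/-- `uᵀ B v = Σ_{ij} B_ij u_i v_j` [cite: BundfussDur2008, Lemma 2 (expansion of the form)]. -/
private theorem form_eq_sum (B : Matrix (Fin m) (Fin m) ℝ) (u v : Fin m → ℝ) :
    u ⬝ᵥ (B *ᵥ v) = ∑ i, ∑ j, B i j * (u i * v j) := by
  simp only [dotProduct, Matrix.mulVec, Finset.mul_sum]
  exact Finset.sum_congr rfl fun i _ => Finset.sum_congr rfl fun j _ => by ring

/-- `pairLower Blo Bhi u v ≤ uᵀ B v` whenever `Blo ≤ B ≤ Bhi` entrywise
[cite: BundfussDur2008, Lemma 6 (relaxed vertex values); interval-matrix form]. -/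
theorem pairLower_le_form {B Blo Bhi : Matrix (Fin m) (Fin m) ℝ} (hB : InBounds B Blo Bhi)
    (u v : Fin m → ℝ) : pairLower Blo Bhi u v ≤ u ⬝ᵥ (B *ᵥ v) := by
  rw [form_eq_sum]
  exact Finset.sum_le_sum fun i _ => Finset.sum_le_sum fun j _ => min_mul_le (hB i j).1 (hB i j).2 _

/-- **Interval vertex criterion.**  If `0 ≤ pairLower Blo Bhi v_s v_t` for all vertex pairs of
`[lo, hi]`, then `0 ≤ xᵀ B y` on the box for EVERY `B` within the bounds
[cite: BundfussDur2008, Lemma 2, Lemma 6; interval-matrix form]. -/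
theorem le_form_of_intervalVertices {lo hi : Fin m → ℝ} {Blo Bhi : Matrix (Fin m) (Fin m) ℝ}
    (hV : ∀ s t : Finset (Fin m), 0 ≤ pairLower Blo Bhi (boxVertex lo hi s) (boxVertex lo hi t))
    {B : Matrix (Fin m) (Fin m) ℝ} (hB : InBounds B Blo Bhi)
    {x y : Fin m → ℝ} (hx : x ∈ Icc lo hi) (hy : y ∈ Icc lo hi) : 0 ≤ x ⬝ᵥ (B *ᵥ y) :=
  le_form_of_vertices B 0 (fun s t => (hV s t).trans (pairLower_le_form hB _ _)) hx hy

/-! ## Certificate (B), part (ii): kd-trees of boxes — coverage by construction -/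

/-- A binary kd-tree over a box: a leaf names the form `k` claimed nonnegative on the leaf's box; a
node splits coordinate `j` at the value `c` into the boxes `[lo, hi[j ↦ c]]` and `[lo[j ↦ c], hi]`
(the bookkeeping device replacing the heuristic search of §3.4 by an a-posteriori check; the
`Prop`-level, real-box analogue of `Literature.Analysis.ValidatedNumerics.KdCert`)
[cite: ChesterEtAl2020, §3.4 (a deterministic procedure for low-dimensional QCQPs is asked for)]. -/
inductive CoverTree (ι : Type*) (m : ℕ) : Type _
  | leaf (k : ι) : CoverTree ι m
  | node (j : Fin m) (c : ℝ) (below above : CoverTree ι m) : CoverTree ι m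

namespace CoverTree

/-- The tree certifies the box `[lo, hi]` for the leaf test `test k lo hi`
[cite: ChesterEtAl2020, §3.4 (a deterministic check)]. -/
def Certifies (test : ι → (Fin m → ℝ) → (Fin m → ℝ) → Prop) :
    CoverTree ι m → (Fin m → ℝ) → (Fin m → ℝ) → Prop
  | leaf k, a, b => test k a b
  | node j c t₁ t₂, a, b =>
      Certifies test t₁ a (Function.update b j c) ∧ Certifies test t₂ (Function.update a j c) b

/-- The lower child of a split contains the points with `x_j ≤ c`
[cite: ChesterEtAl2020, §3.4 (bookkeeping)]. -/
theorem mem_Icc_update_hi {lo hi x : Fin m → ℝ} (hx : x ∈ Icc lo hi) {j : Fin m} {c : ℝ}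
    (h : x j ≤ c) : x ∈ Icc lo (Function.update hi j c) := by
  refine ⟨hx.1, fun i => ?_⟩
  rcases eq_or_ne i j with rfl | hne
  · simpa using h
  · rw [Function.update_of_ne hne]
    exact hx.2 i

/-- The upper child of a split contains the points with `c ≤ x_j`
[cite: ChesterEtAl2020, §3.4 (bookkeeping)]. -/
theorem mem_Icc_update_lo {lo hi x : Fin m → ℝ} (hx : x ∈ Icc lo hi) {j : Fin m} {c : ℝ}
    (h : c ≤ x j) : x ∈ Icc (Function.update lo j c) hi := by
  refine ⟨fun i => ?_, hx.2⟩
  rcases eq_or_ne i j with rfl | hne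
  · simpa using h
  · rw [Function.update_of_ne hne]
    exact hx.1 i

/-- **Coverage by construction.**  If every leaf test is sound for the property `P k`
(`test k lo hi → P k` holds on `[lo, hi]`), a certified tree yields, for every point of its box, a
leaf index `k` with `P k x` — whatever the split values are
[cite: ChesterEtAl2020, §3.3 (Algorithm 1: `𝒜_n = ∅`), §3.4]. -/
theorem forall_exists_of_certifies {test : ι → (Fin m → ℝ) → (Fin m → ℝ) → Prop}
    {P : ι → (Fin m → ℝ) → Prop}
    (hleaf : ∀ k lo hi, test k lo hi → ∀ x ∈ Icc lo hi, P k x) :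
    ∀ (t : CoverTree ι m) (lo hi : Fin m → ℝ), t.Certifies test lo hi →
      ∀ x ∈ Icc lo hi, ∃ k, P k x
  | leaf k, a, b, h, x, hx => ⟨k, hleaf k a b h x hx⟩
  | node j c t₁ t₂, a, b, h, x, hx => by
      rcases le_total (x j) c with hxc | hcx
      · exact forall_exists_of_certifies hleaf t₁ a _ h.1 x (mem_Icc_update_hi hx hxc)
      · exact forall_exists_of_certifies hleaf t₂ _ b h.2 x (mem_Icc_update_lo hx hcx)

end CoverTree

/-- Leaf test, exact data: the `2ᵐ × 2ᵐ` vertex-pair inequalities `0 ≤ v_sᵀ Q_k v_t` on the leaf box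
[cite: BundfussDur2008, Lemma 2]. -/
def vertexTest (Q : ι → Matrix (Fin m) (Fin m) ℝ) (k : ι) (lo hi : Fin m → ℝ) : Prop :=
  ∀ s t : Finset (Fin m), 0 ≤ boxVertex lo hi s ⬝ᵥ (Q k *ᵥ boxVertex lo hi t)

/-- Soundness of the exact leaf test [cite: BundfussDur2008, Lemma 2]. -/
theorem vertexTest_sound (Q : ι → Matrix (Fin m) (Fin m) ℝ) :
    ∀ k lo hi, vertexTest Q k lo hi → ∀ x ∈ Icc lo hi, 0 ≤ x ⬝ᵥ (Q k *ᵥ x) :=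
  fun k _ _ h _ hx => le_form_of_vertices (Q k) 0 h hx hx

/-- Leaf test, interval data: `0 ≤ pairLower (Blo k) (Bhi k) v_s v_t` for all vertex pairs
[cite: BundfussDur2008, Lemma 6; interval-matrix form]. -/
def intervalVertexTest (Blo Bhi : ι → Matrix (Fin m) (Fin m) ℝ) (k : ι) (lo hi : Fin m → ℝ) :
    Prop :=
  ∀ s t : Finset (Fin m), 0 ≤ pairLower (Blo k) (Bhi k) (boxVertex lo hi s) (boxVertex lo hi t)

/-- Soundness of the interval leaf test: the named index works for EVERY matrix within the bounds
[cite: BundfussDur2008, Lemma 2, Lemma 6; interval-matrix form]. -/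
theorem intervalVertexTest_sound (Blo Bhi : ι → Matrix (Fin m) (Fin m) ℝ) :
    ∀ k lo hi, intervalVertexTest Blo Bhi k lo hi →
      ∀ x ∈ Icc lo hi, ∀ B, InBounds B (Blo k) (Bhi k) → 0 ≤ x ⬝ᵥ (B *ᵥ x) :=
  fun _ _ _ h _ hx _ hB => le_form_of_intervalVertices h hB hx hx

/-! ## Certificate (B), part (iii): from the cube's facets to every direction -/

/-- Lower corner of the facet `F_i = {x : x_i = 1, |x_j| ≤ 1}` of the cube `[−1, 1]ᵐ`, as the box
`[facetLo i, 1]` (an affine chart piece of `ℝℙ^{m−1}`) [cite: ChesterEtAl2020, §3.3 (affine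
coordinates on `ℝℙ³`)]. -/
def facetLo (i : Fin m) : Fin m → ℝ := Function.update (fun _ => (-1 : ℝ)) i 1

/-- A point with `x_i = 1` and `|x_j| ≤ 1` lies in the facet box `[facetLo i, 1]`
[cite: ChesterEtAl2020, §3.3 (affine coordinates on `ℝℙ³`)]. -/
theorem mem_facet {x : Fin m → ℝ} {i : Fin m} (hi : x i = 1) (hle : ∀ j, |x j| ≤ 1) :
    x ∈ Icc (facetLo i) (fun _ => (1 : ℝ)) := by
  refine ⟨fun j => ?_, fun j => (abs_le.mp (hle j)).2⟩
  rcases eq_or_ne j i with rfl | hne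
  · simp [facetLo, hi]
  · simp only [facetLo, Function.update_of_ne hne]
    exact (abs_le.mp (hle j)).1

/-- **From facets to all directions.**  If a cone-invariant property `P k` (`P k x → P k (c x)` for
`c ≠ 0`) is available with SOME index on each of the `m` facets `x_i = 1` of the cube, it is
available with some index at every `l ≠ 0`: divide `l` by its coordinate of largest modulus
[cite: ChesterEtAl2020, §3.3 (`[λ] ∈ ℝℙ³`: directions up to scale)]. -/
theorem forall_exists_of_facets {P : ι → (Fin m → ℝ) → Prop}
    (hP : ∀ k (c : ℝ) (x : Fin m → ℝ), c ≠ 0 → P k x → P k (c • x))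
    (h : ∀ i : Fin m, ∀ x ∈ Icc (facetLo i) (fun _ => (1 : ℝ)), ∃ k, P k x) :
    ∀ l : Fin m → ℝ, l ≠ 0 → ∃ k, P k l := by
  intro l hl
  have hne : (Finset.univ : Finset (Fin m)).Nonempty := by
    by_contra h0
    rw [Finset.not_nonempty_iff_eq_empty, Finset.univ_eq_empty_iff] at h0
    exact hl (Subsingleton.elim _ _)
  obtain ⟨i, -, hmax⟩ := Finset.exists_max_image Finset.univ (fun j => |l j|) hne
  have hli : l i ≠ 0 := by
    intro h0
    apply hl
    funext j
    have hj := hmax j (Finset.mem_univ j)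
    rw [h0, abs_zero] at hj
    exact abs_nonpos_iff.mp hj
  set x : Fin m → ℝ := (l i)⁻¹ • l with hx
  have hxi : x i = 1 := by
    simp [hx, hli]
  have habs : ∀ j, |x j| ≤ 1 := by
    intro j
    simp only [hx, Pi.smul_apply, smul_eq_mul, abs_mul, abs_inv]
    rw [← div_eq_inv_mul, div_le_one (abs_pos.mpr hli)]
    exact hmax j (Finset.mem_univ j)
  obtain ⟨k, hk⟩ := h i x (mem_facet hxi habs)
  refine ⟨k, ?_⟩
  have hl' : l = (l i) • x := by
    rw [hx, smul_smul, mul_inv_cancel₀ hli, one_smul]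
  rw [hl']
  exact hP k (l i) x hli hk

/-- Facet version of exhaustion for quadratic forms (which are even and homogeneous, so the facets
`x_i = +1` suffice) [cite: ChesterEtAl2020, §3.3 (Algorithm 1: `𝒜_n = ∅`)]. -/
theorem exhausted_of_facets (Q : ι → Matrix (Fin m) (Fin m) ℝ)
    (h : ∀ i : Fin m, ∀ x ∈ Icc (facetLo i) (fun _ => (1 : ℝ)), ∃ k, 0 ≤ x ⬝ᵥ (Q k *ᵥ x)) :
    Exhausted Q :=
  forall_exists_of_facets (P := fun k x => 0 ≤ x ⬝ᵥ (Q k *ᵥ x))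
    (fun k c x _ hx => by
      show 0 ≤ (c • x) ⬝ᵥ (Q k *ᵥ (c • x))
      rw [form_smul]
      exact mul_nonneg (sq_nonneg c) hx) h

/-- **MAIN (exact data).**  One certified box-tree per facet of the cube, leaf test = the vertex-pair
inequalities for the named form, proves that all directions in OPE space are ruled out
[cite: ChesterEtAl2020, §3.3 (Algorithm 1: `𝒜_n = ∅`), §3.4] [cite: BundfussDur2008, Lemma 2]. -/
theorem exhausted_of_coverTrees (Q : ι → Matrix (Fin m) (Fin m) ℝ) (T : Fin m → CoverTree ι m)
    (hT : ∀ i, (T i).Certifies (vertexTest Q) (facetLo i) (fun _ => (1 : ℝ))) : Exhausted Q :=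
  exhausted_of_facets Q fun i x hx =>
    CoverTree.forall_exists_of_certifies (vertexTest_sound Q) (T i) _ _ (hT i) x hx

/-- Robust exhaustion: for every direction some index `k` works for EVERY matrix within the `k`-th
bounds — the form needed when `B_k = α_k(V⃗_ext)` is only known through interval enclosures (and
varies over a box of external dimensions) [cite: ChesterEtAl2020, §3.3 (`Q_i = α_i(V⃗_ext)`;
`𝒜_n = ∅`)]. -/
def RobustlyExhausted (Blo Bhi : ι → Matrix (Fin m) (Fin m) ℝ) : Prop :=
  ∀ l : Fin m → ℝ, l ≠ 0 → ∃ k, ∀ B, InBounds B (Blo k) (Bhi k) → 0 ≤ l ⬝ᵥ (B *ᵥ l)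

/-- Robust exhaustion implies exhaustion of every family within the bounds
[cite: ChesterEtAl2020, §3.3 (Algorithm 1: `𝒜_n = ∅`)]. -/
theorem RobustlyExhausted.exhausted {Blo Bhi : ι → Matrix (Fin m) (Fin m) ℝ}
    (h : RobustlyExhausted Blo Bhi) {Q : ι → Matrix (Fin m) (Fin m) ℝ}
    (hQ : ∀ k, InBounds (Q k) (Blo k) (Bhi k)) : Exhausted Q := by
  intro l hl
  obtain ⟨k, hk⟩ := h l hl
  exact ⟨k, hk (Q k) (hQ k)⟩

/-- **MAIN (interval data).**  One certified box-tree per facet, leaf test = the interval vertex-pair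
inequalities, proves robust exhaustion [cite: ChesterEtAl2020, §3.3 (Algorithm 1: `𝒜_n = ∅`), §3.4]
[cite: BundfussDur2008, Lemma 2, Lemma 6]. -/
theorem robustlyExhausted_of_coverTrees (Blo Bhi : ι → Matrix (Fin m) (Fin m) ℝ)
    (T : Fin m → CoverTree ι m)
    (hT : ∀ i, (T i).Certifies (intervalVertexTest Blo Bhi) (facetLo i) (fun _ => (1 : ℝ))) :
    RobustlyExhausted Blo Bhi :=
  forall_exists_of_facets (P := fun k x => ∀ B, InBounds B (Blo k) (Bhi k) → 0 ≤ x ⬝ᵥ (B *ᵥ x))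
    (fun k c x _ hx B hB => by
      show 0 ≤ (c • x) ⬝ᵥ (B *ᵥ (c • x))
      rw [form_smul]
      exact mul_nonneg (sq_nonneg c) (hx B hB))
    fun i x hx =>
      CoverTree.forall_exists_of_certifies (intervalVertexTest_sound Blo Bhi) (T i) _ _ (hT i) x hx

/-- A certified tree on an arbitrary box `[lo, hi]` (e.g. an a-priori region of allowed OPE ratios)
rules out every direction in that box [cite: ChesterEtAl2020, §3.3 (scanning a region of `ℝℙ³`)]
[cite: BundfussDur2008, Lemma 2]. -/
theorem forall_exists_of_coverTree_box (Q : ι → Matrix (Fin m) (Fin m) ℝ) (t : CoverTree ι m)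
    {lo hi : Fin m → ℝ} (ht : t.Certifies (vertexTest Q) lo hi) :
    ∀ x ∈ Icc lo hi, ∃ k, 0 ≤ x ⬝ᵥ (Q k *ᵥ x) :=
  CoverTree.forall_exists_of_certifies (vertexTest_sound Q) t lo hi ht

/-! ## `m = 2`: the angle scan -/

/-- For `2 × 2` forms exhaustion is the statement "at every angle `θ` some `Q_k` is nonnegative on
`(cos θ, sin θ)`" — the `θ`-scan [cite: KosPolandSimmonsDuffinVichi2016, §2.1–§2.2 (`θ`-scan;
arXiv:1603.04436)] [cite: ChesterEtAl2020, §3.4 (`m = 2`: forms of a single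
variable on an affine patch of `ℝℙ¹`)]. -/
theorem exhausted_iff_angle (Q : ι → Matrix (Fin 2) (Fin 2) ℝ) :
    Exhausted Q ↔
      ∀ θ : ℝ, ∃ k, 0 ≤ ![Real.cos θ, Real.sin θ] ⬝ᵥ (Q k *ᵥ ![Real.cos θ, Real.sin θ]) := by
  constructor
  · intro h θ
    refine h _ ?_
    intro h0
    have h1 : Real.cos θ = 0 := by simpa using congr_fun h0 0
    have h2 : Real.sin θ = 0 := by simpa using congr_fun h0 1
    have := Real.cos_sq_add_sin_sq θ
    rw [h1, h2] at this
    norm_num at this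
  · intro h l hl
    obtain ⟨z, hzre, hzim⟩ : ∃ z : ℂ, z.re = l 0 ∧ z.im = l 1 := ⟨⟨l 0, l 1⟩, rfl, rfl⟩
    have hz0 : z ≠ 0 := by
      intro h0
      apply hl
      funext j
      fin_cases j
      · simp [← hzre, h0]
      · simp [← hzim, h0]
    obtain ⟨k, hk⟩ := h (Complex.arg z)
    refine ⟨k, ?_⟩
    have hvec : ![Real.cos (Complex.arg z), Real.sin (Complex.arg z)] = ‖z‖⁻¹ • l := by
      funext j
      fin_cases j
      · simp only [Fin.zero_eta, Fin.isValue, Matrix.cons_val_zero, Pi.smul_apply, smul_eq_mul]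
        rw [Complex.cos_arg hz0, div_eq_inv_mul, hzre]
      · simp only [Fin.mk_one, Fin.isValue, Matrix.cons_val_one, Matrix.cons_val_fin_one,
          Pi.smul_apply, smul_eq_mul]
        rw [Complex.sin_arg, div_eq_inv_mul, hzim]
    rw [hvec, form_smul] at hk
    have hc : 0 < (‖z‖⁻¹) ^ 2 := by
      have : 0 < ‖z‖ := norm_pos_iff.mpr hz0
      positivity
    exact (mul_nonneg_iff_of_pos_left hc).mp hk

end Literature.MathematicalPhysics.QuantumFieldTheory.OPESpaceCoverCertificate
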